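import Summits.RiemannHypothesis.RiemannHypothesis.Theorems.GroundBartaGroundBartaFloorApproximants
import Summits.RiemannHypothesis.RiemannHypothesis.Theorems.OddSectorOddBartaFloorEnergyBound
import Literature.NumberTheory.LFunctions.WeilMarkovQuadratic
import Literature.NumberTheory.LFunctions.WeilOddThetaVector
import Literature.NumberTheory.LFunctions.DeBruijnPhiDecreasing
import Literature.Analysis.Calculus.SmoothCutoff
import Mathlib.Analysis.Calculus.MeanValue
import HarnessLib

/-!
# Uniform energy bound for the outer cut-offs `Φ χ_η` (crux `GroundBarta.GroundBartaFloor`,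
stmt-RiemannHypothesis-18389; line `outer_cutoff_harmonic_pairing`, registered stub C
`stub_cutoffEnergyBound`)

For `a > 0` and `0 < η ≤ 1` let `χ_η(t) = cutoff (a/η + 1) (t/η)` (`= 1` on `[-a, a]`, `= 0` off
`(-a-η, a+η)`, values in `[0, 1]`) and `k_η = Φ χ_η`, `Φ = weilThetaPhi`.  Then

  `sup_{0 < η ≤ 1} Re Q(k_η) < ∞`.

Proof.  `χ_η(t) = q(t) q(-t)` with the MONOTONE plateau `q(t) = smoothTransition((t + a + η)/η)`
rising from `0` (on `t ≤ -a-η`) to `1` (on `t ≥ -a`).  Exactly as for the inner approximants of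
`GroundBartaGroundBartaFloorApproximants` (whose three pointwise lemmas are repeated here), the
increments are uniformly Lipschitz: pointwise
`|k_η(x+s) - k_η(x)|² ≤ 4LMs·𝟙_{[-b,b]}(x) + 2M²(Δq(x) + Δr(x))`, `b = a + 1`, `M = Φ(0) ≥ |Φ|`,
`L = sup_{[-b,b]} |Φ'|`, and each plateau increment integrates to EXACTLY `s`
(`∫ (q(x+s) - q(x)) dx = s`, independently of the steepness `1/η`), so
`D_s(k_η) ≤ (8bLM + 4M²) s` for all `s ≥ 0`, uniformly in `η`.  The energy bound for window tests
with a sup bound and Lipschitz increments (`OddBartaFloor.stub_energyBound`, from the Markov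
decomposition `Re Q = P + 𝓔_b - M_b‖·‖²`) concludes.  Elementary; no published source needed.
[folklore]
-/

set_option linter.dupNamespace false

noncomputable section

open Set MeasureTheory Filter Complex
open scoped Real Topology

namespace Summit.RiemannHypothesis.RiemannHypothesis.Theorems.GroundBartaFloor

open Literature.NumberTheory.LFunctions Literature.Analysis.Calculus

/-! ## Three pointwise lemmas (as in `GroundBartaGroundBartaFloorApproximants`) -/

/-- Shift identity for a continuous plateau `q` (`q = 0` on `(-∞, A]`, `q = 1` on `[B, ∞)`): for
`s ≥ 0` the increment `x ↦ q (x + s) - q x` is integrable with integral exactly `s`. [folklore] -/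
theorem cutoffEnergy_shift {q : ℝ → ℝ} (hq : Continuous q) {A B s : ℝ}
    (hA : ∀ x, x ≤ A → q x = 0) (hB : ∀ x, B ≤ x → q x = 1) (hs : 0 ≤ s) :
    Integrable (fun x => q (x + s) - q x) ∧ ∫ x, (q (x + s) - q x) = s := by
  have hAB : A ≤ B :=
    le_of_lt (lt_of_not_ge fun h => one_ne_zero ((hB A h).symm.trans (hA A le_rfl)))
  have hsupp : Function.support (fun x => q (x + s) - q x) ⊆ Ioc (A - s) B := fun x hx => by
    rw [Function.mem_support] at hx
    refine ⟨lt_of_not_ge fun h => hx ?_, le_of_not_gt fun h => hx ?_⟩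
    · rw [hA x (by linarith), hA (x + s) (by linarith), sub_zero]
    · rw [hB x h.le, hB (x + s) (by linarith), sub_self]
  have hqs : Continuous fun x => q (x + s) := by fun_prop
  have hc : Continuous fun x => q (x + s) - q x := hqs.sub hq
  refine ⟨hc.integrable_of_hasCompactSupport (HasCompactSupport.intro isCompact_Icc fun x hx =>
    Function.notMem_support.1 fun h => hx (Ioc_subset_Icc_self (hsupp h))), ?_⟩
  have hi : ∀ u v, IntervalIntegrable q volume u v := fun u v => hq.intervalIntegrable u v
  rw [← intervalIntegral.integral_eq_integral_of_support_subset hsupp,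
    intervalIntegral.integral_sub (hqs.intervalIntegrable _ _) (hi _ _),
    intervalIntegral.integral_comp_add_right, sub_add_cancel,
    ← intervalIntegral.integral_add_adjacent_intervals (hi A B) (hi B (B + s)),
    ← intervalIntegral.integral_add_adjacent_intervals (hi (A - s) A) (hi A B)]
  have h1 : ∫ x in B..B + s, q x = s := by
    rw [intervalIntegral.integral_congr (g := fun _ => (1 : ℝ)) fun x hx => hB x ?_,
      intervalIntegral.integral_const, smul_eq_mul, mul_one, add_sub_cancel_left]
    rw [uIcc_of_le (by linarith)] at hx
    exact hx.1
  have h0 : ∫ x in A - s..A, q x = 0 := by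
    rw [intervalIntegral.integral_congr (g := fun _ => (0 : ℝ)) fun x hx => hA x ?_,
      intervalIntegral.integral_const, smul_zero]
    rw [uIcc_of_le (by linarith)] at hx
    exact hx.2
  rw [h1, h0]
  ring

/-- Plateau algebra: for `0 ≤ a₀ ≤ a₁ ≤ 1` and `0 ≤ b₁ ≤ b₀ ≤ 1`,
`|a₁ b₁ − a₀ b₀| ≤ (a₁ − a₀) + ((1 − b₁) − (1 − b₀))`. [folklore] -/
theorem cutoffEnergy_plateau {a₀ a₁ b₀ b₁ : ℝ} (ha₀ : 0 ≤ a₀) (ha : a₀ ≤ a₁)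
    (ha₁ : a₁ ≤ 1) (hb₁ : 0 ≤ b₁) (hb : b₁ ≤ b₀) (hb₀ : b₀ ≤ 1) :
    |a₁ * b₁ - a₀ * b₀| ≤ (a₁ - a₀) + ((1 - b₁) - (1 - b₀)) := by
  have h1 := mul_nonneg (sub_nonneg.2 ha) (sub_nonneg.2 (hb.trans hb₀))
  have h2 := mul_nonneg ha₀ (sub_nonneg.2 hb)
  have h3 := mul_nonneg (sub_nonneg.2 ha) hb₁
  have h4 := mul_nonneg (sub_nonneg.2 (ha.trans ha₁)) (sub_nonneg.2 hb)
  rw [abs_le]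
  constructor <;> nlinarith [h1, h2, h3, h4]

/-- Pointwise algebra of the increment bound. For plateau values `A, B ∈ [0, 1]` with
`|A - B| ≤ Δ`, amplitudes `|u|, |v| ≤ M`, and `|u - v| ≤ L s` whenever both plateau values are
positive: `(A u - B v)² ≤ 4 L M s · B + 2 M² Δ`. [folklore] -/
theorem cutoffEnergy_alg {A B u v M L s Δ : ℝ} (hM : 0 ≤ M) (hLs : 0 ≤ L * s)
    (hA0 : 0 ≤ A) (hA1 : A ≤ 1) (hB0 : 0 ≤ B) (hB1 : B ≤ 1) (hAB : |A - B| ≤ Δ)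
    (hu : |u| ≤ M) (hv : |v| ≤ M) (huv : 0 < A → 0 < B → |u - v| ≤ L * s) :
    (A * u - B * v) ^ 2 ≤ 4 * L * M * s * B + 2 * M ^ 2 * Δ := by
  have hΔ0 : 0 ≤ Δ := (abs_nonneg _).trans hAB
  have hΔ1 : |A - B| ≤ 1 := abs_sub_le_iff.2 ⟨by linarith, by linarith⟩
  have hu2 : u ^ 2 ≤ M ^ 2 := by simpa only [sq_abs] using pow_le_pow_left₀ (abs_nonneg u) hu 2
  have hv2 : v ^ 2 ≤ M ^ 2 := by simpa only [sq_abs] using pow_le_pow_left₀ (abs_nonneg v) hv 2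
  have hr : ((A - B) * u) ^ 2 ≤ Δ * M ^ 2 := by
    rw [mul_pow, ← sq_abs (A - B)]
    exact mul_le_mul ((pow_le_of_le_one (abs_nonneg _) hΔ1 two_ne_zero).trans hAB) hu2
      (sq_nonneg _) hΔ0
  rcases hA0.eq_or_lt with rfl | hA
  · have hBΔ : B ≤ Δ := by rwa [zero_sub, abs_neg, abs_of_nonneg hB0] at hAB
    have h1 : B * v ^ 2 ≤ Δ * M ^ 2 := mul_le_mul hBΔ hv2 (sq_nonneg _) hΔ0
    have h2 : B * (B * v ^ 2) ≤ B * v ^ 2 := mul_le_of_le_one_left (by positivity) hB1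
    nlinarith [mul_nonneg (mul_nonneg hLs hM) hB0, sq_nonneg (B * v)]
  rcases hB0.eq_or_lt with rfl | hB
  · nlinarith [hr, sq_nonneg (A * u)]
  have hp : (B * (u - v)) ^ 2 ≤ B * (2 * M * (L * s)) := by
    have h1 : |u - v| ≤ 2 * M := (abs_sub _ _).trans (by linarith)
    have h2 : (u - v) ^ 2 ≤ 2 * M * (L * s) := by
      rw [← sq_abs, sq]
      exact mul_le_mul h1 (huv hA hB) (abs_nonneg _) (by linarith)
    rw [mul_pow]
    exact mul_le_mul (pow_le_of_le_one hB0 hB1 two_ne_zero) h2 (sq_nonneg _) hB0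
  nlinarith [hp, hr, sq_nonneg (B * (u - v) - (A - B) * u)]

/-! ## The outer cut-offs have uniformly Lipschitz increments -/

/-- **Uniform Lipschitz increments of the outer cut-offs.**  For `a > 0` there is `K` with
`D_s(Φ χ_η) = ∫ |k_η(x+s) - k_η(x)|² dx ≤ K s` for all `s ≥ 0` and all `0 < η ≤ 1`,
`χ_η = cutoff (a/η + 1) (·/η)` (plateau product `q(x) q(-x)`, shift identity for each monotone
factor). [folklore] -/
theorem cutoffEnergy_increment_le {a : ℝ} (ha : 0 < a) :
    ∃ K : ℝ, ∀ η : ℝ, 0 < η → η ≤ 1 → ∀ s : ℝ, 0 ≤ s →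
      weilIncrement (fun t : ℝ => ((weilThetaPhi t * cutoff (a / η + 1) (t / η) : ℝ) : ℂ)) s ≤
        K * s := by
  set b : ℝ := a + 1 with hb
  have hb0 : 0 < b := by positivity
  have hsmooth := contDiff_weilThetaPhi
  -- the amplitude bound `|Φ| ≤ M = Φ(0)` and the Lipschitz constant of `Φ` on `[-b, b]`
  set M : ℝ := weilThetaPhi 0 with hM
  have hM0 : 0 ≤ M := (weilThetaPhi_pos 0).le
  have hΦM : ∀ t, |weilThetaPhi t| ≤ M := fun t => by
    rw [abs_of_pos (weilThetaPhi_pos t)]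
    rcases eq_or_ne t 0 with rfl | h0
    · exact le_rfl
    · exact (weilThetaPhi_lt_weilThetaPhi_zero h0).le
  obtain ⟨L, hL⟩ := (isCompact_Icc (a := -b) (b := b)).exists_bound_of_continuousOn
    (hsmooth.continuous_deriv (by simp)).continuousOn
  have hL0 : 0 ≤ L := (norm_nonneg _).trans (hL 0 ⟨by linarith, hb0.le⟩)
  have hlip : ∀ x ∈ Icc (-b) b, ∀ y ∈ Icc (-b) b,
      |weilThetaPhi y - weilThetaPhi x| ≤ L * |y - x| := fun x hx y hy => by
    simpa only [Real.norm_eq_abs] using (convex_Icc (-b) b).norm_image_sub_le_of_norm_deriv_le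
      (fun z _ => hsmooth.differentiable (by simp) z) hL hx hy
  refine ⟨8 * b * L * M + 4 * M ^ 2, fun η hη hη1 s hs => ?_⟩
  -- the monotone plateau factor `q`
  obtain ⟨q, hq⟩ : ∃ q : ℝ → ℝ, ∀ x, q x = Real.smoothTransition (x / η + (a / η + 1)) :=
    ⟨_, fun _ => rfl⟩
  have hqc : Continuous q := by
    rw [show q = fun x => Real.smoothTransition (x / η + (a / η + 1)) from funext hq]
    exact Real.smoothTransition.continuous.comp (by fun_prop)
  have hq0 : ∀ x, 0 ≤ q x := fun x => (hq x).symm ▸ Real.smoothTransition.nonneg _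
  have hq1 : ∀ x, q x ≤ 1 := fun x => (hq x).symm ▸ Real.smoothTransition.le_one _
  have hqm : Monotone q := fun x y hxy => by
    rw [hq, hq]
    exact Real.smoothTransition.monotone (by
      have := div_le_div_of_nonneg_right hxy hη.le
      linarith)
  have hqA : ∀ x, x ≤ -a - η → q x = 0 := fun x hx => by
    rw [hq]
    refine Real.smoothTransition.zero_of_nonpos ?_
    have h1 : x / η + (a / η + 1) = (x + a + η) / η := by field_simp; ring
    rw [h1]
    exact div_nonpos_of_nonpos_of_nonneg (by linarith) hη.le
  have hqB : ∀ x, -a ≤ x → q x = 1 := fun x hx => by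
    rw [hq]
    refine Real.smoothTransition.one_of_one_le ?_
    have h1 : x / η + (a / η + 1) = (x + a) / η + 1 := by field_simp; ring
    rw [h1]
    have : 0 ≤ (x + a) / η := div_nonneg (by linarith) hη.le
    linarith
  -- the cut-off is the even plateau `q(x) q(-x)`
  have hχ : ∀ x, cutoff (a / η + 1) (x / η) = q x * q (-x) := fun x => by
    rw [cutoff, hq, hq]
    congr 1
    congr 1
    ring
  have hθ0 : ∀ x, 0 ≤ q x * q (-x) := fun x => mul_nonneg (hq0 x) (hq0 (-x))
  have hθ1 : ∀ x, q x * q (-x) ≤ 1 := fun x => mul_le_one₀ (hq1 x) (hq0 (-x)) (hq1 (-x))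
  have hθz : ∀ x, x ∉ Icc (-b) b → q x * q (-x) = 0 := fun x hx => by
    rcases not_and_or.1 (mt mem_Icc.2 hx) with h | h
    · exact mul_eq_zero_of_left (hqA x (by linarith [not_le.1 h])) _
    · exact mul_eq_zero_of_right _ (hqA (-x) (by linarith [not_le.1 h]))
  have hθW : ∀ x, 0 < q x * q (-x) → x ∈ Icc (-b) b := fun x h0 =>
    by_contra fun hx => h0.ne' (hθz x hx)
  -- the complementary plateau `r(x) = 1 - q(-x)`
  obtain ⟨r, hr⟩ : ∃ r : ℝ → ℝ, ∀ x, r x = 1 - q (-x) := ⟨_, fun _ => rfl⟩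
  have hrc : Continuous r := by
    rw [show r = fun x => 1 - q (-x) from funext hr]
    fun_prop
  obtain ⟨hi1, he1⟩ := cutoffEnergy_shift hqc hqA hqB hs
  obtain ⟨hi2, he2⟩ := cutoffEnergy_shift hrc (A := a) (B := a + η)
    (fun x hx => by rw [hr, hqB (-x) (by linarith), sub_self])
    (fun x hx => by rw [hr, hqA (-x) (by linarith), sub_zero]) hs
  have hind : Integrable ((Icc (-b) b).indicator fun _ => (4 * L * M * s : ℝ)) :=
    (integrableOn_const measure_Icc_lt_top.ne).integrable_indicator measurableSet_Icc
  have hrest : Integrable fun x => 2 * M ^ 2 * ((q (x + s) - q x) + (r (x + s) - r x)) :=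
    (hi1.add hi2).const_mul (2 * M ^ 2)
  -- the pointwise bound
  have hpt : ∀ x, ‖(fun t : ℝ => ((weilThetaPhi t * cutoff (a / η + 1) (t / η) : ℝ) : ℂ)) (x + s) -
        (fun t : ℝ => ((weilThetaPhi t * cutoff (a / η + 1) (t / η) : ℝ) : ℂ)) x‖ ^ 2 ≤
      (Icc (-b) b).indicator (fun _ => 4 * L * M * s) x +
        2 * M ^ 2 * ((q (x + s) - q x) + (r (x + s) - r x)) := fun x => by
    have hΔ : |q (x + s) * q (-(x + s)) - q x * q (-x)| ≤
        (q (x + s) - q x) + (r (x + s) - r x) := by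
      rw [hr, hr]
      exact cutoffEnergy_plateau (hq0 x) (hqm (le_add_of_nonneg_right hs)) (hq1 _) (hq0 _)
        (hqm (neg_le_neg (le_add_of_nonneg_right hs))) (hq1 _)
    dsimp only
    rw [hχ, hχ, ← Complex.ofReal_sub, Complex.norm_real, Real.norm_eq_abs, sq_abs,
      mul_comm (weilThetaPhi (x + s)), mul_comm (weilThetaPhi x)]
    refine (cutoffEnergy_alg hM0 (mul_nonneg hL0 hs) (hθ0 _) (hθ1 _) (hθ0 _) (hθ1 _) hΔ
      (hΦM _) (hΦM _) fun hA hB => ?_).trans (add_le_add ?_ le_rfl)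
    · have hxs := hθW _ hA
      have hx := hθW _ hB
      have := hlip x hx (x + s) hxs
      rwa [add_sub_cancel_left, abs_of_nonneg hs] at this
    · by_cases hx : x ∈ Icc (-b) b
      · rw [indicator_of_mem hx]
        exact mul_le_of_le_one_right (by positivity) (hθ1 x)
      · rw [indicator_of_notMem hx, hθz x hx, mul_zero]
  have hD : Integrable fun x => (Icc (-b) b).indicator (fun _ => 4 * L * M * s) x +
      2 * M ^ 2 * ((q (x + s) - q x) + (r (x + s) - r x)) := hind.add hrest
  unfold weilIncrement
  refine (integral_mono_of_nonneg (Eventually.of_forall fun x => by positivity) hD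
    (Eventually.of_forall hpt)).trans_eq ?_
  rw [integral_add hind hrest, integral_const_mul, integral_add hi1 hi2, he1, he2,
    integral_indicator_const _ measurableSet_Icc, Real.volume_real_Icc_of_le (by linarith),
    smul_eq_mul]
  ring

/-! ## The outer cut-offs are window tests on `[-(a+1), a+1]`, bounded by `Φ(0)` -/

/-- `χ_η = 0` for `|x| ≥ a + η`. [folklore] -/
theorem cutoffEnergy_cutoff_eq_zero {a η x : ℝ} (hη : 0 < η) (hx : a + η ≤ |x|) :
    cutoff (a / η + 1) (x / η) = 0 := by
  apply cutoff_eq_zero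
  rw [abs_div, abs_of_pos hη, le_div_iff₀ hη, add_mul, div_mul_cancel₀ _ hη.ne', one_mul]
  exact hx

/-- The outer cut-off `k_η = Φ χ_η` is a Weil test function supported in `[-(a+1), a+1]` with
`‖k_η‖ ≤ Φ(0)`, for `0 < η ≤ 1`. [folklore] -/
theorem cutoffEnergy_test {a η : ℝ} (hη : 0 < η) (hη1 : η ≤ 1) :
    IsWeilTest (fun t : ℝ => ((weilThetaPhi t * cutoff (a / η + 1) (t / η) : ℝ) : ℂ)) ∧
      tsupport (fun t : ℝ => ((weilThetaPhi t * cutoff (a / η + 1) (t / η) : ℝ) : ℂ)) ⊆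
        Icc (-(a + 1)) (a + 1) ∧
      ∀ t, ‖(fun t : ℝ => ((weilThetaPhi t * cutoff (a / η + 1) (t / η) : ℝ) : ℂ)) t‖ ≤
        weilThetaPhi 0 := by
  have hzero : ∀ t, t ∉ Ioo (-(a + η)) (a + η) →
      (fun t : ℝ => ((weilThetaPhi t * cutoff (a / η + 1) (t / η) : ℝ) : ℂ)) t = 0 := by
    intro t ht
    have hta : a + η ≤ |t| := by
      simp only [mem_Ioo, not_and_or, not_lt] at ht
      rcases ht with h | h
      · exact (by linarith : a + η ≤ -t).trans (neg_le_abs t)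
      · exact h.trans (le_abs_self t)
    simp [cutoffEnergy_cutoff_eq_zero hη hta]
  refine ⟨⟨?_, ?_⟩, ?_, fun t => ?_⟩
  · exact Complex.ofRealCLM.contDiff.comp
      (contDiff_weilThetaPhi.mul ((contDiff_cutoff _).comp (contDiff_id.div_const η)))
  · exact HasCompactSupport.intro (isCompact_Icc (a := -(a + η)) (b := a + η)) fun t ht =>
      hzero t fun h => ht (Ioo_subset_Icc_self h)
  · refine closure_minimal (fun t ht => ?_) isClosed_Icc
    by_contra h
    exact ht (hzero t fun h' => h ⟨by linarith [h'.1], by linarith [h'.2]⟩)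
  · dsimp only
    rw [Complex.norm_real, Real.norm_eq_abs, abs_mul, abs_of_pos (weilThetaPhi_pos t),
      abs_of_nonneg (cutoff_nonneg _ _)]
    refine (mul_le_of_le_one_right (weilThetaPhi_pos t).le (cutoff_le_one _ _)).trans ?_
    rcases eq_or_ne t 0 with rfl | h0
    · exact le_rfl
    · exact (weilThetaPhi_lt_weilThetaPhi_zero h0).le

/-! ## The stub -/

/-- **Stub C — uniform energy bound for the outer cut-offs.**  With
`χ_η = cutoff (a/η + 1) (·/η)` (`= 1` on `[-a,a]`, supported in `[-a-η, a+η]`),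
`sup_{0<η≤1} Re Q(Φ χ_η) < ∞`: uniformly Lipschitz increments (`cutoffEnergy_increment_le`) and
the energy bound for window tests with a sup bound and Lipschitz increments
(`OddBartaFloor.stub_energyBound`, Markov decomposition `Re Q = P + 𝓔_{a+1} - M_{a+1}‖·‖²`).
[folklore] -/
theorem stub_cutoffEnergyBound :
    ∀ a : ℝ, 0 < a → ∃ C : ℝ, ∀ η : ℝ, 0 < η → η ≤ 1 →
      (weilQuadratic (fun t : ℝ =>
        ((weilThetaPhi t * Literature.Analysis.Calculus.cutoff (a / η + 1) (t / η) : ℝ) : ℂ))).re ≤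
        C := by
  intro a ha
  obtain ⟨K, hK⟩ := cutoffEnergy_increment_le ha
  obtain ⟨C, hC⟩ := OddBartaFloor.stub_energyBound (a + 1) (weilThetaPhi 0) K (by positivity)
  refine ⟨C, fun η hη hη1 => ?_⟩
  obtain ⟨htest, hsupp, hbd⟩ := cutoffEnergy_test (a := a) hη hη1
  exact hC _ htest hsupp hbd (hK η hη hη1)

end Summit.RiemannHypothesis.RiemannHypothesis.Theorems.GroundBartaFloor

end
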